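import Summits.RiemannHypothesis.RiemannHypothesis.Theses.SpectralTrace
import Summits.RiemannHypothesis.RiemannHypothesis.Theorems.SpectralTraceWindowTraceToPositivity
import Literature.NumberTheory.LFunctions.UniformWeilPositivityRH
import HarnessLib

/-!
# RiemannHypothesis / SpectralTrace — the assembly item `Assembly`

Route `RiemannHypothesis/SpectralTrace`, item stmt-RiemannHypothesis-0188 (`Assembly`, assembly,
rank 1):

  `X → Summit.RiemannHypothesis`,

where `X` (the route's thesis `SpectralThesis`) says that some real family `γ : ι → ℝ` reproduces
the Weil functional on every Weil test: `HasSum (i ↦ ĝ(1/2 + iγ_i)) (W g)`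
(`ĝ = weilMellin g`, `W = weilFunctional`).

Proof (Bochner direction of Weil's criterion, Bombieri 2000 §2–3 / Yoshida 1992 §2, then Weil's
criterion, Bombieri 2000 Thm. 2, which is a theorem of the tree: `weil_criterion_holds`). A trace
identity on ALL Weil tests is in particular a window trace `Trace(A)` for every `A`, so by the
proved support item `WindowTraceToPositivity` (`spectralTrace_hasSum_norm_sq_of_windowTrace`:
`Re Q(g) = Σ_i |ĝ(1/2 + iγ_i)|² ≥ 0`) Weil positivity holds on every truncated cone `[-a, a]`,
and Yoshida's form of Weil's criterion (`riemannHypothesis_iff_forall_weilPositivityOn`,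
unconditional in the tree) gives Mathlib's `RiemannHypothesis`, which is the summit statement
(`Summit.RiemannHypothesis_iff`).

References: E. Bombieri, *Remarks on Weil's quadratic functional in the theory of prime numbers I*,
Rend. Mat. Acc. Lincei (9) 11 (2000), §2 and Thms. 1–2; H. Yoshida, Adv. Stud. Pure Math. 21
(1992), §2 and Thm. 1.
-/

noncomputable section

-- D-0017: single-problem summit ⇒ namespace `Summit.RiemannHypothesis.RiemannHypothesis.…` by design
-- (the Summits library sets `weak.linter.dupNamespace = false`; repeated here for standalone checks).
set_option linter.dupNamespace false

open Complex Set

namespace Summit.RiemannHypothesis.RiemannHypothesis.Theorems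

open Literature.NumberTheory.LFunctions
open Summit.RiemannHypothesis.RiemannHypothesis.Theses.SpectralTrace

/-- **A global trace identity forces Weil positivity on every cone.** If a real family `γ`
reproduces the Weil functional on every Weil test (`HasSum (i ↦ ĝ(1/2 + iγ_i)) (W g)`), then
`WeilPositivityOn a` for every `a`: for `g` supported in `[-a, a]`,
`Re Q(g) = Σ_i |ĝ(1/2 + iγ_i)|²` is a sum of non-negative reals
(`spectralTrace_hasSum_norm_sq_of_windowTrace` with the window `[-2a, 2a]`, whose support
hypothesis is vacuous here). (Bombieri 2000 §2 / Yoshida 1992 §2, easy direction of Weil's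
criterion.) [folklore] -/
theorem spectralTrace_weilPositivityOn_of_trace {ι : Type*} {γ : ι → ℝ}
    (h : ∀ g : ℝ → ℂ, IsWeilTest g →
      HasSum (fun i => weilMellin g (1 / 2 + (γ i : ℂ) * I)) (weilFunctional g))
    (a : ℝ) : WeilPositivityOn a := by
  intro g hg hgs
  have hwin : ∀ k : ℝ → ℂ, IsWeilTest k → tsupport k ⊆ Icc (-(2 * a)) (2 * a) →
      HasSum (fun i => weilMellin k (1 / 2 + (γ i : ℂ) * I)) (weilFunctional k) :=
    fun k hk _ => h k hk
  have hgs' : tsupport g ⊆ Icc (-(2 * a / 2)) (2 * a / 2) := by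
    simpa only [mul_div_cancel_left₀ a (two_ne_zero : (2 : ℝ) ≠ 0)] using hgs
  exact (spectralTrace_hasSum_norm_sq_of_windowTrace hwin hg hgs').nonneg fun i => by positivity

/-- **Assembly of route SpectralTrace** (item stmt-RiemannHypothesis-0188, `Assembly`, proved
outright): the thesis `X` — a real family `γ : ι → ℝ` with `HasSum (i ↦ ĝ(1/2 + iγ_i)) (W g)` for
every Weil test `g` — implies the Riemann hypothesis. `X` gives Weil positivity on every cone
`[-a, a]` (`spectralTrace_weilPositivityOn_of_trace`: `Re W(g ⋆ g̃) = Σ_i |ĝ(1/2 + iγ_i)|² ≥ 0`),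
and Yoshida's form of Weil's criterion `RiemannHypothesis ↔ ∀ a > 0, WeilPositivityOn a` is a
theorem of the tree (`riemannHypothesis_iff_forall_weilPositivityOn`, from `weil_criterion_holds`,
Bombieri 2000 Thm. 2 = explicit formula + Thm. 1); the summit statement is Mathlib's
`RiemannHypothesis` (`Summit.RiemannHypothesis_iff`). [folklore] -/
theorem spectralTrace_assembly_proof : Assembly := by
  unfold Assembly
  rintro ⟨ι, γ, h⟩
  exact Summit.RiemannHypothesis_iff.mpr
    (riemannHypothesis_iff_forall_weilPositivityOn.mpr fun a _ =>
      spectralTrace_weilPositivityOn_of_trace h a)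

end Summit.RiemannHypothesis.RiemannHypothesis.Theorems

end
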